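import Summits.AtomisticToContinuum.BoseEinsteinCondensation.Theorems.BECStronglyRayleighLatticeToPeriodicBridgeCellPairSumRule
import Literature.MathematicalPhysics.QuantumManyBody.LiebYngvasonPoincare
import Literature.MathematicalPhysics.QuantumManyBody.LiebYngvasonLowerBound
import Literature.MathematicalPhysics.QuantumManyBody.LiebYngvasonBoxBound
import Literature.MathematicalPhysics.QuantumManyBody.PeriodicBoseGasUpperBoundProofs
import Literature.MathematicalPhysics.QuantumManyBody.CondensateOccupationStability
import Literature.MathematicalPhysics.QuantumManyBody.BoseGasThermodynamicLimitRuelle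
import Literature.MathematicalPhysics.QuantumManyBody.PeriodicBoseGasThm31
import Literature.MathematicalPhysics.QuantumManyBody.DiluteBoseGasUpperBoundLocalization

/-!
# Route `BECStronglyRayleigh`, crux `LatticeToPeriodicBridge` (stmt-AtomisticToContinuum-9674),
# line `coarse-cell-lorentzian` — few bosons on a large torus are condensed (the few-body corner of the sandwich)

Helper file of the crux line `coarse-cell-lorentzian`, landed `--supports stmt-AtomisticToContinuum-9674`. It supplies the
few-body corner left open by `…PairFromSingle.lean` (`stub_pairKernelRowFlatness_of_condensateFloor` asks the near-minimisers with
`N + 1 < 2/c` to be `2/(N+1)`-condensed): for every repulsive finite-range `v` and every particle-number cap `N₀` there is a side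
`L₂` such that on every torus of side `L ≥ L₂`, every `L⁻³`-near-minimiser of `2 ≤ N ≤ N₀` bosons has `n₀ ≥ (2/3)·N`
(`fewBody_condensed`). Proof: the periodic ground-state energy is `≤ 4πa(1+Cc)N₀²/L³` by LSSY Thm 2.2 (PROVED in the tree,
`LSSY2005_upperBound_periodic_holds`), so a near-minimiser has `∫|∇Ψ|² ≤ (K+1)/L³`; the Neumann Poincaré–Wirtinger inequality of
the cube `[0,L)^{3N}` (`poincare_boxN`, gap `π²/L²`) makes `Ψ` `L²`-close to its mean `c̄` (`‖Ψ − c̄‖² ≤ (K+1)/(π²L) ≤ 1/144`), the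
constant state `c̄` has `n₀ = N·‖c̄·1‖² ≥ N(1 − η)²` (Minkowski), and the `L²`-Lipschitz bound of `n₀` on the unit ball
(`condensateOccupation_le_add_lintegral_rpow`) transfers this to `n₀(Ψ) ≥ N(1 − 4η) ≥ 2N/3`.

References: LSSY 2005 Thm 2.2 (2.14), after (2.50) (Neumann gap), App. A (A.11)–(A.13).
-/

noncomputable section

open MeasureTheory Filter Metric Set
open scoped ENNReal Topology NNReal Real

namespace Summit.AtomisticToContinuum.BoseEinsteinCondensation.Cruxes.LatticeToPeriodicBridge.CoarseCellLorentzian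

namespace FewBody

open Literature.MathematicalPhysics.QuantumManyBody.BoseGas
open Literature.MathematicalPhysics.QuantumManyBody.BoseGas.Poincare

/-! ## The energy of few bosons on a large torus is `O(L⁻³)` -/

/-- **Few-body energy ceiling.** For every repulsive finite-range `v` and cap `N₀` there are `K ≥ 0` and `L₃ > 0` such that
`E₀^per(N, L) ≤ K/L³` for all `2 ≤ N ≤ N₀` and `L ≥ L₃` (LSSY Thm 2.2 with `ρ₁ = (N-1)/L³ → 0`; `K = 4πa(1+Cc)N₀²`). [folklore] -/
theorem exists_energy_ceiling (v : ℝ → ℝ≥0∞) (hv : IsRepulsiveFiniteRange v) (N₀ : ℕ) :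
    ∃ K : ℝ, 0 ≤ K ∧ ∃ L₃ : ℝ, 0 < L₃ ∧ ∀ L : ℝ, L₃ ≤ L → ∀ N : ℕ, 2 ≤ N → N ≤ N₀ →
      periodicGroundStateEnergy v N L ≤ ENNReal.ofReal (K / L ^ 3) := by
  obtain ⟨hmeas, R₀, hR₀⟩ := hv
  have hfin : scatteringLength v ≠ ⊤ := scatteringLength_ne_top_of_finiteRange hR₀
  obtain ⟨C, c, hC, hc, H⟩ := LSSY2005_upperBound_periodic_holds v R₀ hmeas hR₀ hfin
  set a : ℝ := (scatteringLength v).toReal with ha_def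
  have ha0 : 0 ≤ a := ENNReal.toReal_nonneg
  refine ⟨4 * Real.pi * a * (1 + C * c) * (N₀ : ℝ) ^ 2, by positivity,
    max (max 1 (2 * R₀ + 1)) (4 * Real.pi * (a + 1) ^ 3 * N₀ / (3 * c ^ 3) + 1),
    lt_max_of_lt_left (lt_max_of_lt_left one_pos), fun L hL N hN2 hNN₀ => ?_⟩
  have hL1 : 1 ≤ L := (le_max_left _ _).trans ((le_max_left _ _).trans hL)
  have hL0 : 0 < L := one_pos.trans_le hL1
  have hRL : 2 * R₀ < L := by
    have := (le_max_right _ _).trans ((le_max_left _ _).trans hL); linarith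
  have hLρ : 4 * Real.pi * (a + 1) ^ 3 * N₀ / (3 * c ^ 3) + 1 ≤ L := (le_max_right _ _).trans hL
  have hL3 : (0 : ℝ) < L ^ 3 := by positivity
  have hLL3 : L ≤ L ^ 3 := by
    have h1 : 1 ≤ L ^ 2 := one_le_pow₀ hL1
    calc L = L * 1 := (mul_one L).symm
      _ ≤ L * L ^ 2 := mul_le_mul_of_nonneg_left h1 hL0.le
      _ = L ^ 3 := by ring
  have hNr : (2 : ℝ) ≤ N := by exact_mod_cast hN2
  have hNN₀r : (N : ℝ) ≤ N₀ := by exact_mod_cast hNN₀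
  -- the reduced density `ρ₁ = (N-1)/L³ ≤ N₀/L³ < 3c³/(4π(a+1)³)`
  set ρ' : ℝ := ((N : ℝ) - 1) / L ^ 3 with hρ'_def
  have hρ'0 : 0 ≤ ρ' := div_nonneg (by linarith) hL3.le
  have hρ'le : ρ' ≤ N₀ / L ^ 3 := by
    rw [hρ'_def]; exact div_le_div_of_nonneg_right (by linarith) hL3.le
  have hρ'lt : ρ' < 3 * c ^ 3 / (4 * Real.pi * (a + 1) ^ 3) := by
    have hden : 0 < 4 * Real.pi * (a + 1) ^ 3 := by positivity
    refine hρ'le.trans_lt ?_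
    rw [div_lt_iff₀ hL3, div_mul_eq_mul_div, lt_div_iff₀ hden]
    have h1 : 4 * Real.pi * (a + 1) ^ 3 * (N₀ : ℝ) < 3 * c ^ 3 * L := by
      have : 4 * Real.pi * (a + 1) ^ 3 * N₀ / (3 * c ^ 3) < L := by linarith
      rw [div_lt_iff₀ (by positivity)] at this
      linarith
    nlinarith [mul_le_mul_of_nonneg_left hLL3 (by positivity : (0 : ℝ) ≤ 3 * c ^ 3)]
  have hx0 : 0 ≤ 4 * Real.pi * ρ' / 3 := by positivity
  have hab : a * (4 * Real.pi * ρ' / 3) ^ ((1 : ℝ) / 3) ≤ c := by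
    -- `t = (4πρ'/3)^{1/3}` has `t³ < (c/(a+1))³`, so `a t ≤ (a+1) t ≤ c`
    set t : ℝ := (4 * Real.pi * ρ' / 3) ^ ((1 : ℝ) / 3) with ht
    have ht0 : 0 ≤ t := Real.rpow_nonneg (by positivity) _
    have ht3 : t ^ 3 = 4 * Real.pi * ρ' / 3 := by
      rw [ht, show ((1 : ℝ) / 3) = ((3 : ℕ) : ℝ)⁻¹ by norm_num,
        Real.rpow_inv_natCast_pow (by positivity) three_ne_zero]
    have ha1 : 0 < a + 1 := by linarith
    have hlt : t ^ 3 < (c / (a + 1)) ^ 3 := by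
      rw [ht3, div_pow, lt_div_iff₀ (by positivity)]
      have h := hρ'lt
      rw [lt_div_iff₀ (by positivity)] at h
      linarith
    have htc : t < c / (a + 1) := lt_of_pow_lt_pow_left₀ 3 (by positivity) hlt
    calc a * t ≤ (a + 1) * t := by nlinarith
      _ ≤ (a + 1) * (c / (a + 1)) := by gcongr
      _ = c := by field_simp
  have hL1' := H N L hN2 hL0 hRL
  simp only [] at hL1'
  have hab' : a / (4 * Real.pi * (((N : ℝ) - 1) / L ^ 3) / 3) ^ (-(1 : ℝ) / 3) ≤ c := by
    rw [div_rpow_neg_third hx0]; exact hab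
  have hE := hL1' hab'
  rw [div_rpow_neg_third hx0] at hE
  refine hE.trans (ENNReal.ofReal_le_ofReal ?_)
  -- `4π ρ' a (1 + C a/b) N ≤ 4π a (1+Cc) N₀² / L³`
  have h1 : 1 + C * (a * (4 * Real.pi * ρ' / 3) ^ ((1 : ℝ) / 3)) ≤ 1 + C * c := by nlinarith
  have h2 : ρ' * (N : ℝ) ≤ (N₀ : ℝ) ^ 2 / L ^ 3 := by
    calc ρ' * N ≤ N₀ / L ^ 3 * N₀ := mul_le_mul hρ'le hNN₀r (by positivity) (by positivity)
      _ = (N₀ : ℝ) ^ 2 / L ^ 3 := by ring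
  calc 4 * Real.pi * ρ' * a * (1 + C * (a * (4 * Real.pi * ρ' / 3) ^ ((1 : ℝ) / 3))) * N
      = 4 * Real.pi * a * (1 + C * (a * (4 * Real.pi * ρ' / 3) ^ ((1 : ℝ) / 3))) * (ρ' * N) := by ring
    _ ≤ 4 * Real.pi * a * (1 + C * c) * ((N₀ : ℝ) ^ 2 / L ^ 3) := by
        apply mul_le_mul _ h2 (by positivity) (by positivity)
        exact mul_le_mul_of_nonneg_left h1 (by positivity)
    _ = 4 * Real.pi * a * (1 + C * c) * (N₀ : ℝ) ^ 2 / L ^ 3 := by ring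

/-! ## The constant state and the mean of a near-constant state -/

section Torus

variable {n : ℕ} {L : ℝ}

/-- **`n₀` of a constant** `N`-body function: `n₀(κ) = N · ∫_{cell^N} |κ|²` (`= N|κ|²L^{3N}`). [folklore] -/
theorem condensateOccupation_const (hL : 0 < L) (κ : ℂ) :
    condensateOccupation (n + 1) L (fun _ => κ) =
      ((n : ℝ≥0∞) + 1) * ∫⁻ _X in cellN (n + 1) L, (‖κ‖₊ : ℝ≥0∞) ^ 2 := by
  rw [condensateOccupation_succ hL]
  congr 1
  have hL3 : (0 : ℝ) ≤ L ^ 3 := by positivity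
  have hint : ∫ _x in cell L, κ = ((L ^ 3 : ℝ) : ℂ) * κ := by
    rw [setIntegral_const, measureReal_def, volume_cell, ← ENNReal.ofReal_pow hL.le,
      ENNReal.toReal_ofReal hL3, Complex.real_smul]
  simp only [hint]
  rw [setLIntegral_const, setLIntegral_const, volume_cellN, volume_cellN, coe_nnnorm_mul_sq]
  have hP : ((‖((L ^ 3 : ℝ) : ℂ)‖₊ : ℝ≥0∞)) = ENNReal.ofReal L ^ 3 := by
    rw [← enorm_eq_nnnorm, ← ofReal_norm, Complex.norm_real, Real.norm_of_nonneg hL3,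
      ENNReal.ofReal_pow hL.le]
  rw [hP]
  set P : ℝ≥0∞ := ENNReal.ofReal L ^ 3 with hPdef
  have hP0 : P ≠ 0 := pow_ne_zero _ (by simpa using hL)
  have hPtop : P ≠ ⊤ := ENNReal.pow_ne_top ENNReal.ofReal_ne_top
  calc P⁻¹ * (P ^ 2 * (‖κ‖₊ : ℝ≥0∞) ^ 2 * P ^ n) = P⁻¹ * P * (P * (‖κ‖₊ : ℝ≥0∞) ^ 2 * P ^ n) := by ring
    _ = (‖κ‖₊ : ℝ≥0∞) ^ 2 * P ^ (n + 1) := by rw [ENNReal.inv_mul_cancel hP0 hPtop, one_mul]; ring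

/-- **Poincaré on the torus cell** for a periodic trial state: `(π²/L²) ∫_{cell^N} |Ψ − c̄|² ≤ E_v[Ψ]`, `c̄` the mean of `Ψ` over
the open box (Neumann gap of the cube; the interaction is only dropped). [folklore] -/
theorem sq_dist_mean_le_energy (hL : 0 < L) (v : ℝ → ℝ≥0∞) {N : ℕ} (Ψ : PeriodicTrialState N L) :
    ENNReal.ofReal (π ^ 2 / L ^ 2) *
        ∫⁻ X in cellN N L, (‖Ψ.ψ X - ⨍ Y in boxN N L, Ψ.ψ Y‖₊ : ℝ≥0∞) ^ 2 ≤ periodicEnergy v Ψ := by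
  have h := poincare_boxN N L hL Ψ.ψ Ψ.contDiff
  rw [setLIntegral_congr (boxN_ae_eq_cellN N L), setLIntegral_congr (boxN_ae_eq_cellN N L)] at h
  exact h.trans (lintegral_mono fun X => le_self_add)

/-- **The mean has norm at most one on the cell**: `∫_{cell^N} |c̄|² ≤ 1` for the box mean `c̄` of a normalised state
(Cauchy–Schwarz). [folklore] -/
theorem lintegral_mean_sq_le_one (hL : 0 < L) {N : ℕ} (Ψ : PeriodicTrialState N L) :
    ∫⁻ _X in cellN N L, (‖⨍ Y in boxN N L, Ψ.ψ Y‖₊ : ℝ≥0∞) ^ 2 ≤ 1 := by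
  set V : ℝ≥0∞ := volume (cellN N L) with hV
  have hVbox : volume (boxN N L) = V := measure_congr (boxN_ae_eq_cellN N L)
  have hVeq : V = (ENNReal.ofReal L ^ 3) ^ N := volume_cellN N L
  have hV0 : V ≠ 0 := by rw [hVeq]; exact pow_ne_zero _ (pow_ne_zero _ (by simpa using hL))
  have hVtop : V ≠ ⊤ := by rw [hVeq]; exact ENNReal.pow_ne_top (ENNReal.pow_ne_top ENNReal.ofReal_ne_top)
  -- `‖∫_{box} Ψ‖² ≤ V · ∫_{box} |Ψ|² = V`
  have hCS := CellPairSumRule.sq_nnnorm_setIntegral_le (μ := volume) (s := boxN N L) (h := Ψ.ψ)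
    Ψ.contDiff.continuous.aestronglyMeasurable
  rw [hVbox, setLIntegral_congr (boxN_ae_eq_cellN N L), Ψ.norm_eq, mul_one] at hCS
  -- the mean is `V.toReal⁻¹ • ∫_{box} Ψ`
  have hmean : (⨍ Y in boxN N L, Ψ.ψ Y) = (V.toReal)⁻¹ • ∫ Y in boxN N L, Ψ.ψ Y := by
    rw [setAverage_eq, measureReal_def, hVbox]
  have hVreal : 0 < V.toReal := ENNReal.toReal_pos hV0 hVtop
  have hnn : (‖⨍ Y in boxN N L, Ψ.ψ Y‖₊ : ℝ≥0∞) = V⁻¹ * ‖∫ Y in boxN N L, Ψ.ψ Y‖₊ := by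
    rw [hmean, ← enorm_eq_nnnorm, enorm_smul, Real.enorm_eq_ofReal (inv_nonneg.2 hVreal.le),
      ENNReal.ofReal_inv_of_pos hVreal, ENNReal.ofReal_toReal hVtop, enorm_eq_nnnorm]
  rw [setLIntegral_const, hnn, mul_pow]
  calc V⁻¹ ^ 2 * (‖∫ Y in boxN N L, Ψ.ψ Y‖₊ : ℝ≥0∞) ^ 2 * V ≤ V⁻¹ ^ 2 * V * V := by gcongr
    _ = (V⁻¹ * V) * (V⁻¹ * V) := by ring
    _ = 1 := by rw [ENNReal.inv_mul_cancel hV0 hVtop, one_mul]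

/-- **Minkowski**: `1 ≤ ‖Ψ − κ‖₂ + ‖κ·1‖₂` on the cell, for a normalised state and any constant `κ`. [folklore] -/
theorem one_le_dist_add_const {N : ℕ} (Ψ : PeriodicTrialState N L) (κ : ℂ) :
    1 ≤ (∫⁻ X in cellN N L, (‖Ψ.ψ X - κ‖₊ : ℝ≥0∞) ^ 2) ^ (1 / 2 : ℝ) +
      (∫⁻ _X in cellN N L, (‖κ‖₊ : ℝ≥0∞) ^ 2) ^ (1 / 2 : ℝ) := by
  have hΨm : Measurable fun X => (‖Ψ.ψ X - κ‖₊ : ℝ≥0∞) :=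
    (Ψ.contDiff.continuous.sub continuous_const).measurable.nnnorm.coe_nnreal_ennreal
  have hM := ENNReal.lintegral_Lp_add_le (μ := volume.restrict (cellN N L)) (f := fun X => (‖Ψ.ψ X - κ‖₊ : ℝ≥0∞))
    (g := fun _ => (‖κ‖₊ : ℝ≥0∞)) hΨm.aemeasurable aemeasurable_const (by norm_num : (1 : ℝ) ≤ 2)
  simp only [Pi.add_apply, ENNReal.rpow_two] at hM
  have hpt : ∀ X, ((‖Ψ.ψ X‖₊ : ℝ≥0∞)) ^ 2 ≤ ((‖Ψ.ψ X - κ‖₊ : ℝ≥0∞) + ‖κ‖₊) ^ 2 := fun X => by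
    gcongr
    have h := nnnorm_add_le (Ψ.ψ X - κ) κ
    rw [sub_add_cancel] at h
    exact_mod_cast h
  have h1 : (1 : ℝ≥0∞) = (∫⁻ X in cellN N L, ((‖Ψ.ψ X‖₊ : ℝ≥0∞)) ^ 2) ^ (1 / 2 : ℝ) := by
    rw [Ψ.norm_eq, ENNReal.one_rpow]
  rw [h1]
  exact (ENNReal.rpow_le_rpow (lintegral_mono hpt) (by norm_num)).trans hM

end Torus

/-! ## Few bosons on a large torus are condensed -/

/-- **Few-body condensation.** For every repulsive finite-range `v` and every cap `N₀` there is `L₂ > 0` such that for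
`L ≥ L₂` and `2 ≤ N ≤ N₀`, every `L⁻³`-near-minimiser of the periodic `N`-body energy on the torus of side `L` has
`n₀ ≥ (2/3)·N`. [folklore] -/
theorem fewBody_condensed (v : ℝ → ℝ≥0∞) (hv : IsRepulsiveFiniteRange v) (N₀ : ℕ) :
    ∃ L₂ : ℝ, 0 < L₂ ∧ ∀ L : ℝ, L₂ ≤ L → ∀ n : ℕ, n + 2 ≤ N₀ →
      ∀ Ψ : PeriodicTrialState (n + 2) L,
        periodicEnergy v Ψ ≤ periodicGroundStateEnergy v (n + 2) L + ENNReal.ofReal (1 / L ^ 3) →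
          ENNReal.ofReal (2 / 3 * ((n : ℝ) + 2)) ≤ condensateOccupation (n + 2) L Ψ.ψ := by
  obtain ⟨K, hK, L₃, hL₃, hceil⟩ := exists_energy_ceiling v hv N₀
  refine ⟨max L₃ (144 * (K + 1) / π ^ 2), lt_max_of_lt_left hL₃, fun L hL n hn Ψ hΨ => ?_⟩
  have hπ : 0 < π := Real.pi_pos
  have hL₃L : L₃ ≤ L := (le_max_left _ _).trans hL
  have hLK : 144 * (K + 1) / π ^ 2 ≤ L := (le_max_right _ _).trans hL
  have hL0 : 0 < L := hL₃.trans_le hL₃L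
  have hL3 : (0 : ℝ) < L ^ 3 := by positivity
  have hNr : ((n + 2 : ℕ) : ℝ) = (n : ℝ) + 2 := by push_cast; ring
  have hNpos : (0 : ℝ) < (n : ℝ) + 2 := by positivity
  -- energy of the near-minimiser: `E(Ψ) ≤ (K+1)/L³`
  have hE : periodicEnergy v Ψ ≤ ENNReal.ofReal ((K + 1) / L ^ 3) := by
    have h0 := hceil L hL₃L (n + 2) (by omega) hn
    calc periodicEnergy v Ψ ≤ periodicGroundStateEnergy v (n + 2) L + ENNReal.ofReal (1 / L ^ 3) := hΨ
      _ ≤ ENNReal.ofReal (K / L ^ 3) + ENNReal.ofReal (1 / L ^ 3) := add_le_add h0 le_rfl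
      _ = ENNReal.ofReal ((K + 1) / L ^ 3) := by
          rw [← ENNReal.ofReal_add (by positivity) (by positivity)]; congr 1; ring
  -- Poincaré: `D = ∫|Ψ - c̄|² ≤ (K+1)/(π² L) ≤ 1/144`
  set cbar : ℂ := ⨍ Y in boxN (n + 2) L, Ψ.ψ Y with hcbar
  set D : ℝ≥0∞ := ∫⁻ X in cellN (n + 2) L, (‖Ψ.ψ X - cbar‖₊ : ℝ≥0∞) ^ 2 with hD
  have hP := sq_dist_mean_le_energy hL0 v Ψ
  have hD144 : D ≤ ENNReal.ofReal (1 / 144) := by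
    have h1 : D * ENNReal.ofReal (π ^ 2 / L ^ 2) ≤ ENNReal.ofReal ((K + 1) / L ^ 3) := by
      rw [mul_comm]; exact hP.trans hE
    have hπL : 0 < π ^ 2 / L ^ 2 := by positivity
    have h2 : D ≤ ENNReal.ofReal ((K + 1) / L ^ 3) / ENNReal.ofReal (π ^ 2 / L ^ 2) :=
      (ENNReal.le_div_iff_mul_le (Or.inl (by rwa [Ne, ENNReal.ofReal_eq_zero, not_le]))
        (Or.inl ENNReal.ofReal_ne_top)).2 h1
    rw [← ENNReal.ofReal_div_of_pos hπL] at h2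
    refine h2.trans (ENNReal.ofReal_le_ofReal ?_)
    have hrw : (K + 1) / L ^ 3 / (π ^ 2 / L ^ 2) = (K + 1) / (L * π ^ 2) := by
      field_simp
    rw [hrw, div_le_div_iff₀ (by positivity) (by norm_num)]
    rw [div_le_iff₀ (by positivity)] at hLK
    nlinarith
  -- `η = D^{1/2} ≤ 1/12`
  set η : ℝ≥0∞ := D ^ (1 / 2 : ℝ) with hη
  have hη12 : η ≤ ENNReal.ofReal (1 / 12) := by
    rw [hη, show (1 / 12 : ℝ) = Real.sqrt (1 / 144) by
      rw [show (1 / 144 : ℝ) = (1 / 12) ^ 2 by norm_num, Real.sqrt_sq (by norm_num)],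
      ← ofReal_rpow_half_eq_sqrt (by norm_num)]
    exact ENNReal.rpow_le_rpow hD144 (by norm_num)
  have hηtop : η ≠ ⊤ := ne_top_of_le_ne_top ENNReal.ofReal_ne_top hη12
  -- the constant state `c̄`: `G = ∫|c̄|² ≤ 1`, `s = G^{1/2}`, `1 ≤ η + s`, `n₀(c̄) = N G`
  set G : ℝ≥0∞ := ∫⁻ _X in cellN (n + 2) L, (‖cbar‖₊ : ℝ≥0∞) ^ 2 with hG
  have hG1 : G ≤ 1 := lintegral_mean_sq_le_one hL0 Ψ
  have hGtop : G ≠ ⊤ := ne_top_of_le_ne_top ENNReal.one_ne_top hG1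
  set sG : ℝ≥0∞ := G ^ (1 / 2 : ℝ) with hsG
  have hsGtop : sG ≠ ⊤ := ENNReal.rpow_ne_top_of_nonneg (by norm_num) hGtop
  have hMink : 1 ≤ η + sG := one_le_dist_add_const Ψ cbar
  have hn0c : condensateOccupation (n + 2) L (fun _ => cbar) = (((n + 1 : ℕ) : ℝ≥0∞) + 1) * G :=
    condensateOccupation_const (n := n + 1) hL0 cbar
  have hcast : (((n + 1 : ℕ) : ℝ≥0∞) + 1) = ((n + 2 : ℕ) : ℝ≥0∞) := by push_cast; ring
  rw [hcast] at hn0c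
  -- Lipschitz transfer from `c̄` to `Ψ`
  have hΨc := Ψ.contDiff.continuous
  have hLip := condensateOccupation_le_add_lintegral_rpow (N := n + 2) hL0 (Φ := fun _ => cbar) (Ψ := Ψ.ψ)
    continuous_const hΨc hG1 Ψ.norm_eq.le
  have hrev : ∫⁻ X in cellN (n + 2) L, (‖cbar - Ψ.ψ X‖₊ : ℝ≥0∞) ^ 2 = D := by
    refine lintegral_congr fun X => ?_
    rw [← neg_sub, nnnorm_neg]
  rw [hn0c, hrev] at hLip
  -- `hLip : N G ≤ n₀(Ψ) + 2 N η`; finiteness of `n₀(Ψ)`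
  have hn₀le : condensateOccupation (n + 2) L Ψ.ψ ≤ ((n + 2 : ℕ) : ℝ≥0∞) := by
    have h := condensateOccupation_le_card_mul_lintegral hL0 (Ψ := Ψ.ψ) hΨc
    rwa [Ψ.norm_eq, mul_one] at h
  have hn₀top : condensateOccupation (n + 2) L Ψ.ψ ≠ ⊤ :=
    ne_top_of_le_ne_top (ENNReal.natCast_ne_top (n + 2)) hn₀le
  have h2N : 2 * ((n + 2 : ℕ) : ℝ≥0∞) ≠ ⊤ := ENNReal.mul_ne_top ENNReal.ofNat_ne_top (ENNReal.natCast_ne_top _)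
  -- pass to reals
  set g : ℝ := G.toReal with hg
  set e : ℝ := η.toReal with he
  set sr : ℝ := sG.toReal with hsr
  set m : ℝ := (condensateOccupation (n + 2) L Ψ.ψ).toReal with hm
  have hg0 : 0 ≤ g := ENNReal.toReal_nonneg
  have he0 : 0 ≤ e := ENNReal.toReal_nonneg
  have hsr0 : 0 ≤ sr := ENNReal.toReal_nonneg
  have hm0 : 0 ≤ m := ENNReal.toReal_nonneg
  have he12 : e ≤ 1 / 12 := by
    have := ENNReal.toReal_mono ENNReal.ofReal_ne_top hη12
    rwa [ENNReal.toReal_ofReal (by norm_num)] at this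
  have hsr2 : sr ^ 2 = g := by
    rw [hsr, hsG, ← ENNReal.toReal_rpow, ← hg, ← Real.sqrt_eq_rpow, Real.sq_sqrt hg0]
  have hMink_r : 1 ≤ e + sr := by
    have h := ENNReal.toReal_mono (ENNReal.add_ne_top.2 ⟨hηtop, hsGtop⟩) hMink
    rwa [ENNReal.toReal_one, ENNReal.toReal_add hηtop hsGtop] at h
  have hLip_r : ((n : ℝ) + 2) * g ≤ m + 2 * ((n : ℝ) + 2) * e := by
    have hfin : condensateOccupation (n + 2) L Ψ.ψ + 2 * ((n + 2 : ℕ) : ℝ≥0∞) * η ≠ ⊤ :=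
      ENNReal.add_ne_top.2 ⟨hn₀top, ENNReal.mul_ne_top h2N hηtop⟩
    have h := ENNReal.toReal_mono hfin hLip
    rw [ENNReal.toReal_mul, ENNReal.toReal_natCast, ENNReal.toReal_add hn₀top (ENNReal.mul_ne_top h2N hηtop),
      ENNReal.toReal_mul, ENNReal.toReal_mul, ENNReal.toReal_ofNat, ENNReal.toReal_natCast, hNr] at h
    exact h
  -- `m ≥ N g - 2 N e ≥ N (1 - e)² - 2 N e ≥ N (1 - 4e) ≥ (2/3) N`
  have hsr1 : 1 - e ≤ sr := by linarith
  have hg1e : (1 - e) ^ 2 ≤ g := by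
    rw [← hsr2]
    exact pow_le_pow_left₀ (by linarith) hsr1 2
  have hA := mul_le_mul_of_nonneg_left hg1e hNpos.le
  have hB := mul_le_mul_of_nonneg_left he12 hNpos.le
  have hC : 0 ≤ ((n : ℝ) + 2) * e ^ 2 := by positivity
  have hm23 : 2 / 3 * ((n : ℝ) + 2) ≤ m := by nlinarith
  calc ENNReal.ofReal (2 / 3 * ((n : ℝ) + 2)) ≤ ENNReal.ofReal m := ENNReal.ofReal_le_ofReal hm23
    _ = condensateOccupation (n + 2) L Ψ.ψ := ENNReal.ofReal_toReal hn₀top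

end FewBody

/-- **Registered form of few-body condensation** (sub-goal `fewBodyCondensed` of the crux item, signature verbatim, fully
qualified; = `FewBody.fewBody_condensed`). [folklore] -/
theorem fewBodyCondensed : ∀ (v : ℝ → ENNReal), Literature.MathematicalPhysics.QuantumManyBody.BoseGas.IsRepulsiveFiniteRange v → ∀ (N₀ : ℕ), ∃ L₂ : ℝ, 0 < L₂ ∧ ∀ L : ℝ, L₂ ≤ L → ∀ n : ℕ, n + 2 ≤ N₀ → ∀ Ψ : Literature.MathematicalPhysics.QuantumManyBody.BoseGas.PeriodicTrialState (n + 2) L, Literature.MathematicalPhysics.QuantumManyBody.BoseGas.periodicEnergy v Ψ ≤ Literature.MathematicalPhysics.QuantumManyBody.BoseGas.periodicGroundStateEnergy v (n + 2) L + ENNReal.ofReal (1 / L ^ 3) → ENNReal.ofReal (2 / 3 * ((n : ℝ) + 2)) ≤ Literature.MathematicalPhysics.QuantumManyBody.BoseGas.condensateOccupation (n + 2) L Ψ.ψ :=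
  fun v hv N₀ => FewBody.fewBody_condensed v hv N₀

end Summit.AtomisticToContinuum.BoseEinsteinCondensation.Cruxes.LatticeToPeriodicBridge.CoarseCellLorentzian

end
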